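import Literature.AnabelianGeometry.SemiGraphs.CoveringGraphEquiv
import Literature.AnabelianGeometry.SemiGraphs.CoveringProducts
import Literature.AnabelianGeometry.SemiGraphs.TemperedFunctorialityWith
import Literature.AnabelianGeometry.SemiGraphs.ProfiniteHomToAnabPullback
import Literature.AnabelianGeometry.SemiGraphs.UniformSplittingProofs
import HarnessLib

/-!
# [SemiAnbd] Proposition 3.6 (v), the ÉTALE clause in full: the equivalence `B^cov(G)_S ≌ B^cov(G_S)`
# carries `S × −` to the pull-back along `G_S → G`

Mochizuki, *Semi-graphs of anabelioids*, Publ. RIMS **42** (2006), §3, Proposition 3.6 (v), manuscript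
p. 39 [cite: MochizukiSemiAnbd2006, Prop 3.6(v) p.39]: "Suppose that `G` is coherent, and that we are given
a tempered covering `G′ → G`. Then the resulting morphism of temperoids `B^temp(G′) → B^temp(G)` is
*étale*", where (Definition 3.4 (i), p. 36) a morphism of temperoids `φ : T₁ → T₂` is étale when there are an
object `A` of `T₂` and an equivalence `T₁ ⥲ (T₂)_A` under which the pull-back functor `φ^* : T₂ → T₁`
becomes `T₂ → (T₂)_A`, `B ↦ (A × B → A)`.

The tree types Proposition 3.6 (v) as the BARE equivalence `B^temp(G_S) ≌ B^temp(G)_S`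
(`EtaleOfTemperedCovering`, PROVED `etaleOfTemperedCovering_holds`; `B^cov`-level `CovObj.coveringEquiv`,
`CoveringGraphEquiv.lean`), with the compatibility with the structure functors RECORDED, NOT TYPED
(`TemperedReconstruction.lean`, module docstring; referee ruling ι2): the pull-back functor `Hom.covPullback`
of `G_S → G` glues along `Classical.choose`-n conjugating elements, so it is canonical only up to the 2-cell
indeterminacy of Remark 2.4.2.  The pull-back for an ARBITRARY family of 2-cells, `Hom.covPullbackWith θ`
(`TemperedFunctorialityWith.lean`), removes the obstruction: for the covering morphism
`CovObj.coveringHom S : G_S → G` the 2-cells ARE given — they are the chosen elements `g_{b′}` of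
Definition 3.5 (i) realising the incidences of `G_S` (`CovObj.conjugator`) — and for THAT family the
compatibility holds ON THE NOSE up to a canonical isomorphism.  PROOF-ONLY apart from bookkeeping
definitions (projections of the product covering, the functor `T ↦ (S × T → S)`, the conjugator family):

* `CovObj.prodFst`, `CovObj.prodSnd`, `CovObj.prodMap`, `CovObj.prodOver S : B^cov(G) ⥤ B^cov(G)_S`
  (`T ↦ (S × T → S)`, the functor "`B ↦ A × B`" of Def. 3.4 (i) for `CovObj.prod` of `CoveringProducts`);
* `CovObj.coveringConjugators S : (S.coveringHom).ConjugatorFamily` — the 2-cells of `G_S → G`;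
* ★ `CovObj.toCoveringProdIso S T : S.toCovering.obj ((S.prodOver).obj T) ≅
     (S.coveringHom.covPullbackWith S.coveringConjugators).obj T` — over the orbit `(v, ω)` the fibre of
  `S_v × T_v → S_v` at the base point `x_ω` IS `T_v` with `Stab(x_ω)` acting, and the gluings agree
  conjugator by conjugator; natural in `T`:
* ★ `CovObj.prodOverToCoveringIso S : S.prodOver ⋙ S.toCovering ≅ S.coveringHom.covPullbackWith _` —
  i.e. under `coveringEquiv : B^cov(G)_S ≌ B^cov(G_S)` the structure functor `T ↦ S × T` of the slice IS
  the pull-back along `G_S → G`: Definition 3.4 (i) "étale" for the morphism `B^cov(G_S) → B^cov(G)`, hence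
  (restricting to the full subcategories of tempered objects, `CoveringGraphTempered` /
  `EtaleOfTemperedCoveringProofs`) for `B^temp(G_S) → B^temp(G)`.

Cell abc-iut, seat abc-iut-L3-d6 (ROUTE T lineage), faithfulness upgrade of node SemiAnbd:Prop3.6(v); no new
named fact, no hypothesis; nothing here bears on [IUTchIII] Cor. 3.12; typed ≠ proved elsewhere.
-/

noncomputable section

open CategoryTheory Topology

namespace Literature.AnabelianGeometry.SemiGraphs

open Literature.AlgebraicGeometry.Frobenioids.QuasiTemperoid.BTempConnected (hom_ρ hom_ext_apply
  ρ_one_apply ρ_mul_apply ρ_inv_apply)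

universe u

namespace ProfiniteSemiGraph

namespace CovObj

variable {𝒢 : ProfiniteSemiGraph.{u}} (S : CovObj 𝒢)

/-! ### The product covering as an object over `S`, functorially in the second factor -/

/-- The gluing of the product covering on points: `glue_{S×T}(s, t) = (glue_S s, glue_T t)`.
[cite: MochizukiSemiAnbd2006, Prop 3.6(v) p.39] -/
theorem prod_glue_apply (T : CovObj 𝒢) (b : 𝒢.graph.Branch) (v : 𝒢.graph.Vertex)
    (h : 𝒢.graph.abuts b = some v) (p : (S.SE (𝒢.graph.edgeOf b)).obj.V × (T.SE (𝒢.graph.edgeOf b)).obj.V) :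
    ((S.prod T).glue b v h).hom.hom.hom p =
      (((S.glue b v h).hom.hom.hom p.1, (T.glue b v h).hom.hom.hom p.2) :
        (S.SV v).obj.V × (T.SV v).obj.V) :=
  rfl

/-- The first projection `S × T → S` of the product covering. [cite: MochizukiSemiAnbd2006, Prop 3.6(v) p.39] -/
def prodFst (T : CovObj 𝒢) : S.prod T ⟶ S where
  fV _ := BTemp.homOfEquivariant _ _ Prod.fst fun _ _ => rfl
  fE _ := BTemp.homOfEquivariant _ _ Prod.fst fun _ _ => rfl
  comm _ _ _ := hom_ext_apply fun _ => rfl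

/-- The second projection `S × T → T` of the product covering. [cite: MochizukiSemiAnbd2006, Prop 3.6(v) p.39] -/
def prodSnd (T : CovObj 𝒢) : S.prod T ⟶ T where
  fV _ := BTemp.homOfEquivariant _ _ Prod.snd fun _ _ => rfl
  fE _ := BTemp.homOfEquivariant _ _ Prod.snd fun _ _ => rfl
  comm _ _ _ := hom_ext_apply fun _ => rfl

/-- `S × f : S × T → S × T′`. [cite: MochizukiSemiAnbd2006, Prop 3.6(v) p.39] -/
def prodMap {T T' : CovObj 𝒢} (f : T ⟶ T') : S.prod T ⟶ S.prod T' where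
  fV v := BTemp.homOfEquivariant _ _ (fun p => (p.1, (f.fV v).hom.hom p.2)) fun g p =>
    Prod.ext rfl (hom_ρ (f.fV v) g p.2)
  fE e := BTemp.homOfEquivariant _ _ (fun p => (p.1, (f.fE e).hom.hom p.2)) fun g p =>
    Prod.ext rfl (hom_ρ (f.fE e) g p.2)
  comm b v h := hom_ext_apply fun p => Prod.ext rfl (glue_hom_apply f b v h p.2)

/-- **The structure functor of the slice**, `T ↦ (S × T → S)` (the functor "`B ↦ A × B`" of
Definition 3.4 (i), p. 36). [cite: MochizukiSemiAnbd2006, Def 3.4(i) p.36] -/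
def prodOver : CovObj 𝒢 ⥤ Over S where
  obj T := Over.mk (S.prodFst T)
  map f := Over.homMk (S.prodMap f) (by
    refine CovHom.ext (funext fun v => ?_) (funext fun e => ?_) <;> exact hom_ext_apply fun _ => rfl)
  map_id T := by
    ext1
    refine CovHom.ext (funext fun v => ?_) (funext fun e => ?_) <;> exact hom_ext_apply fun _ => rfl
  map_comp f g := by
    ext1
    refine CovHom.ext (funext fun v => ?_) (funext fun e => ?_) <;> exact hom_ext_apply fun _ => rfl

/-! ### The 2-cells of the covering morphism `G_S → G` -/

/-- **The 2-cells of `G_S → G`**: the chosen elements `g_{b′} ∈ Π_v` of Definition 3.5 (i) realising the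
incidences of the covering semi-graph (`CovObj.conjugator`) form a family of conjugating elements for
`CovObj.coveringHom S` — by construction of its branch homomorphisms `k ↦ g_{b′} b_*(k) g_{b′}⁻¹`.
[cite: MochizukiSemiAnbd2006, Def 3.5(i) p.37] -/
def coveringConjugators : (S.coveringHom).ConjugatorFamily where
  θ b' v' h' := S.conjugator (b := b'.1) (ω := b'.2) (v := v'.1) (ωv := v'.2) h'
  spec _ _ _ _ := rfl

/-! ### The fibre of `S × T → S` at a base point is `T` restricted to the stabiliser -/

section Fibre

variable (T : CovObj 𝒢)

/-- Over the vertex-orbit `(v, ω)`: the fibre of `S_v × T_v → S_v` at the base point `x_ω`, as a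
`Stab(x_ω)`-set, is `T_v` with `Stab(x_ω) ≤ Π_v` acting — the bijection `(x_ω, t) ↦ t`.
[cite: MochizukiSemiAnbd2006, Prop 3.6(v) p.39] -/
def prodFibreEquivV (v' : S.coveringGraph.graph.Vertex) :
    ((S.toCovering.obj (S.prodOver.obj T)).SV v').obj.V ≃
      (((S.coveringHom.covPullbackWith S.coveringConjugators).obj T).SV v').obj.V where
  toFun p := p.1.2
  invFun t := ⟨(Quot.out v'.2, t), rfl⟩
  left_inv p := Subtype.ext (Prod.ext p.2.symm rfl)
  right_inv _ := rfl

/-- The same over the edge-orbit `(e, ω)`. [cite: MochizukiSemiAnbd2006, Prop 3.6(v) p.39] -/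
def prodFibreEquivE (e' : S.coveringGraph.graph.Edge) :
    ((S.toCovering.obj (S.prodOver.obj T)).SE e').obj.V ≃
      (((S.coveringHom.covPullbackWith S.coveringConjugators).obj T).SE e').obj.V where
  toFun p := p.1.2
  invFun t := ⟨(Quot.out e'.2, t), rfl⟩
  left_inv p := Subtype.ext (Prod.ext p.2.symm rfl)
  right_inv _ := rfl

/-- The vertex components of the comparison isomorphism. [cite: MochizukiSemiAnbd2006, Prop 3.6(v) p.39] -/
def prodFibreIsoV (v' : S.coveringGraph.graph.Vertex) :
    (S.toCovering.obj (S.prodOver.obj T)).SV v' ≅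
      ((S.coveringHom.covPullbackWith S.coveringConjugators).obj T).SV v' :=
  BTemp.isoOfEquiv (S.prodFibreEquivV T v') fun _ _ => rfl

/-- The edge components of the comparison isomorphism. [cite: MochizukiSemiAnbd2006, Prop 3.6(v) p.39] -/
def prodFibreIsoE (e' : S.coveringGraph.graph.Edge) :
    (S.toCovering.obj (S.prodOver.obj T)).SE e' ≅
      ((S.coveringHom.covPullbackWith S.coveringConjugators).obj T).SE e' :=
  BTemp.isoOfEquiv (S.prodFibreEquivE T e') fun _ _ => rfl

/-- The vertex components on points: `(s, t) ↦ t`. [cite: MochizukiSemiAnbd2006, Prop 3.6(v) p.39] -/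
@[simp] theorem prodFibreIsoV_hom_apply (v' : S.coveringGraph.graph.Vertex)
    (p : ((S.toCovering.obj (S.prodOver.obj T)).SV v').obj.V) :
    (S.prodFibreIsoV T v').hom.hom.hom p = p.1.2 :=
  rfl

/-- The edge components on points: `(s, t) ↦ t`. [cite: MochizukiSemiAnbd2006, Prop 3.6(v) p.39] -/
@[simp] theorem prodFibreIsoE_hom_apply (e' : S.coveringGraph.graph.Edge)
    (p : ((S.toCovering.obj (S.prodOver.obj T)).SE e').obj.V) :
    (S.prodFibreIsoE T e').hom.hom.hom p = p.1.2 :=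
  rfl

/-- **The gluings agree, conjugator by conjugator**: along the branch-orbit `b′ = (b, ω) → (v, ω_v)` the
covering-side gluing sends `(x_ω, t)` to `g_{b′} · (glue_S x_ω, glue_T t) = (x_{ω_v}, g_{b′} · glue_T t)`,
and the pull-back glued with the 2-cell `g_{b′}` sends `t` to `g_{b′} · glue_T t`.
[cite: MochizukiSemiAnbd2006, Prop 3.6(v) p.39] -/
theorem prodFibreIso_comm (b' : S.coveringGraph.graph.Branch) (v' : S.coveringGraph.graph.Vertex)
    (h' : S.coveringGraph.graph.abuts b' = some v') :
    (S.prodFibreIsoE T (S.coveringGraph.graph.edgeOf b')).hom ≫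
        (((S.coveringHom.covPullbackWith S.coveringConjugators).obj T).glue b' v' h').hom =
      ((S.toCovering.obj (S.prodOver.obj T)).glue b' v' h').hom ≫
        (BTemp.res (S.coveringGraph.brHom b' v' h')).map (S.prodFibreIsoV T v').hom := by
  apply hom_ext_apply
  intro p
  change (((S.coveringHom.covPullbackWith S.coveringConjugators).obj T).glue b' v' h').hom.hom.hom p.1.2 =
    (((S.toCovering.obj (S.prodOver.obj T)).glue b' v' h').hom.hom.hom p).1.2
  rw [Hom.covPullbackWith_glue_apply]
  rfl

/-- ★ **The comparison isomorphism** `toCovering_S (S × T → S) ≅ (G_S → G)^*_θ T` for the 2-cells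
`θ = (g_{b′})` of Definition 3.5 (i). [cite: MochizukiSemiAnbd2006, Prop 3.6(v) p.39] -/
def toCoveringProdIso :
    S.toCovering.obj (S.prodOver.obj T) ≅ (S.coveringHom.covPullbackWith S.coveringConjugators).obj T :=
  CovObj.isoOfComponents (S.prodFibreIsoV T) (S.prodFibreIsoE T) (S.prodFibreIso_comm T)

end Fibre

/-- ★ **[SemiAnbd] Proposition 3.6 (v), the étale clause (Def. 3.4 (i)) at the level of `B^cov`**: under
the comparison `toCovering_S : B^cov(G)_S ⥤ B^cov(G_S)` (an equivalence, `coveringEquiv`), the structure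
functor `T ↦ (S × T → S)` of the slice is NATURALLY ISOMORPHIC to the pull-back functor of the covering
morphism `G_S → G` glued with its 2-cells `(g_{b′})`:
`prodOver_S ⋙ toCovering_S ≅ (G_S → G)^*_θ`. [cite: MochizukiSemiAnbd2006, Prop 3.6(v) p.39] -/
def prodOverToCoveringIso :
    S.prodOver ⋙ S.toCovering ≅ S.coveringHom.covPullbackWith S.coveringConjugators :=
  NatIso.ofComponents (fun T => S.toCoveringProdIso T) fun f => by
    refine CovHom.ext (funext fun v' => ?_) (funext fun e' => ?_) <;> exact hom_ext_apply fun _ => rfl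


/-! ### The product of tempered coverings is tempered -/

section Tempered

variable (T : CovObj 𝒢)

/-- The first projection on points `(c, (s, t)) ↦ (c, s)`. [cite: MochizukiSemiAnbd2006, Def 3.5(ii) p.37] -/
def prodPointFst : (S.prod T).Point → S.Point
  | Sum.inl ⟨v, p⟩ => Sum.inl ⟨v, p.1⟩
  | Sum.inr ⟨e, p⟩ => Sum.inr ⟨e, p.1⟩

/-- The second projection on points `(c, (s, t)) ↦ (c, t)`. [cite: MochizukiSemiAnbd2006, Def 3.5(ii) p.37] -/
def prodPointSnd : (S.prod T).Point → T.Point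
  | Sum.inl ⟨v, p⟩ => Sum.inl ⟨v, p.2⟩
  | Sum.inr ⟨e, p⟩ => Sum.inr ⟨e, p.2⟩

/-- Points of `S × T` in one connected component have first projections in one connected component of
`S`. [cite: MochizukiSemiAnbd2006, Def 3.5(ii) p.37] -/
theorem sameComponent_prodPointFst {p q : (S.prod T).Point} (hpq : (S.prod T).SameComponent p q) :
    S.SameComponent (S.prodPointFst T p) (S.prodPointFst T q) := by
  induction hpq with
  | rel a b hab =>
    cases hab with
    | vertex v g x => exact Relation.EqvGen.rel _ _ (CovObj.Adj.vertex v g x.1)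
    | edge e g x => exact Relation.EqvGen.rel _ _ (CovObj.Adj.edge e g x.1)
    | glue b v h x => exact Relation.EqvGen.rel _ _ (CovObj.Adj.glue b v h x.1)
  | refl a => exact Relation.EqvGen.refl _
  | symm a b _ ih => exact Relation.EqvGen.symm _ _ ih
  | trans a b c _ _ ih₁ ih₂ => exact Relation.EqvGen.trans _ _ _ ih₁ ih₂

/-- … and second projections in one connected component of `T`. [cite: MochizukiSemiAnbd2006, Def 3.5(ii) p.37] -/
theorem sameComponent_prodPointSnd {p q : (S.prod T).Point} (hpq : (S.prod T).SameComponent p q) :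
    T.SameComponent (S.prodPointSnd T p) (S.prodPointSnd T q) := by
  induction hpq with
  | rel a b hab =>
    cases hab with
    | vertex v g x => exact Relation.EqvGen.rel _ _ (CovObj.Adj.vertex v g x.2)
    | edge e g x => exact Relation.EqvGen.rel _ _ (CovObj.Adj.edge e g x.2)
    | glue b v h x => exact Relation.EqvGen.rel _ _ (CovObj.Adj.glue b v h x.2)
  | refl a => exact Relation.EqvGen.refl _
  | symm a b _ ih => exact Relation.EqvGen.symm _ _ ih
  | trans a b c _ _ ih₁ ih₂ => exact Relation.EqvGen.trans _ _ _ ih₁ ih₂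

/-- If `F₁` splits `S` at `(c, s)` and `F₂` splits `T` at `(c, t)` then `F₁ × F₂` splits `S × T` at
`(c, (s, t))`. [cite: MochizukiSemiAnbd2006, Def 3.5(ii) p.37] -/
theorem prod_splitsAt_prod {F₁ F₂ : CovObj 𝒢} {q : (S.prod T).Point}
    (h₁ : F₁.SplitsAt S (S.prodPointFst T q)) (h₂ : F₂.SplitsAt T (S.prodPointSnd T q)) :
    (F₁.prod F₂).SplitsAt (S.prod T) q := by
  rcases q with ⟨w, p⟩ | ⟨e, p⟩
  · exact prod_splitsAt_inl fun x x' γ hx hx' => Prod.ext (h₁ x γ hx) (h₂ x' γ hx')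
  · exact prod_splitsAt_inr fun x x' γ hx hx' => Prod.ext (h₁ x γ hx) (h₂ x' γ hx')

variable {S T} in
/-- **The product of tempered coverings is tempered** (p. 39 "the fiber product covering": the component
of `(s, t)` is split constituent by constituent by the product of the finite étale coverings splitting the
components of `s` and of `t`). [cite: MochizukiSemiAnbd2006, Def 3.5(ii) p.37] -/
theorem isTempered_prod (hS : S.IsTempered) (hT : T.IsTempered) : (S.prod T).IsTempered := by
  intro p
  obtain ⟨F₁, hF₁, hne₁, hsp₁⟩ := hS (S.prodPointFst T p)
  obtain ⟨F₂, hF₂, hne₂, hsp₂⟩ := hT (S.prodPointSnd T p)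
  exact ⟨F₁.prod F₂, prod_isFinite hF₁ hF₂, prod_hasNonemptyFibres hne₁ hne₂, fun q hpq =>
    S.prod_splitsAt_prod T (hsp₁ _ (S.sameComponent_prodPointFst T hpq))
      (hsp₂ _ (S.sameComponent_prodPointSnd T hpq))⟩

end Tempered

/-! ### The étale clause at the level of `B^temp` -/

section BTempLevel

/-- **The structure functor of the slice `B^temp(G)_S`**: `T ↦ (S × T → S)` on tempered objects (the
functor "`B ↦ A × B`" of Definition 3.4 (i) for `A = S`). [cite: MochizukiSemiAnbd2006, Def 3.4(i) p.36] -/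
def btempProdOver (hS : S.IsTempered) : BTempCat 𝒢 ⥤ Over (⟨S, hS⟩ : BTempCat 𝒢) :=
  ObjectProperty.lift S.temperedOver (ObjectProperty.ι _ ⋙ S.prodOver)
      (fun T => isTempered_prod hS T.property) ⋙
    S.overBTempInverse hS

/-- The structure functor of `B^temp(G)_S` lies over that of `B^cov(G)_S` (definitional).
[cite: MochizukiSemiAnbd2006, Def 3.4(i) p.36] -/
theorem btempProdOver_obj_left_obj (hS : S.IsTempered) (T : BTempCat 𝒢) :
    ((S.btempProdOver hS).obj T).left.obj = S.prod T.obj := rfl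

/-- ★ **[SemiAnbd] Proposition 3.6 (v), the étale clause (Def. 3.4 (i)) at the level of `B^temp`**, for
the INVERSE functor of the étale equivalence `CovObj.etaleEquiv : B^temp(G_S) ≌ B^temp(G)_S`:
`(T ↦ S × T → S) ⋙ (B^temp(G)_S ⥲ B^temp(G_S)) ≅ (G_S → G)^*_θ` on `B^temp(G)` — the slice structure
functor followed by the equivalence IS the pull-back of tempered coverings along the covering morphism
`G_S → G` (glued with its 2-cells `g_{b′}`), under the hypotheses of Proposition 3.6 (v) with print's
splitting sentence `UniformSplitting` (PROVED, `uniformSplitting_holds`).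
[cite: MochizukiSemiAnbd2006, Prop 3.6(v) p.39] -/
def btempProdOverEtaleInverseIso (hS : S.IsTempered) (hU : UniformSplitting.{u})
    (h36 : 𝒢.Prop36Hypotheses) (hcoh : 𝒢.IsCoherent) :
    S.btempProdOver hS ⋙ (S.etaleEquiv hU h36 hcoh hS).inverse ≅
      S.coveringHom.btempPullbackWith S.coveringConjugators :=
  ((ObjectProperty.fullyFaithfulι _).whiskeringRight _).preimageIso
    (Functor.isoWhiskerLeft (ObjectProperty.ι _) S.prodOverToCoveringIso)

/-- ★ **[SemiAnbd] Proposition 3.6 (v), the étale clause, functor direction**: the pull-back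
`(G_S → G)^*_θ : B^temp(G) → B^temp(G_S)` followed by the étale equivalence `B^temp(G_S) ⥲ B^temp(G)_S`
is naturally isomorphic to the structure functor `T ↦ (S × T → S)` — Definition 3.4 (i) as unfolded in
the module header (print: étale = "abstractly equivalent to a morphism of the form `T_T → T`"; here the
pull-back functor becomes `T₂ → (T₂)_A`, `B ↦ (A × B → A)`). [cite: MochizukiSemiAnbd2006, Prop 3.6(v) p.39] -/
def btempPullbackEtaleFunctorIso (hS : S.IsTempered) (hU : UniformSplitting.{u})
    (h36 : 𝒢.Prop36Hypotheses) (hcoh : 𝒢.IsCoherent) :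
    S.coveringHom.btempPullbackWith S.coveringConjugators ⋙ (S.etaleEquiv hU h36 hcoh hS).functor ≅
      S.btempProdOver hS :=
  Functor.isoWhiskerRight (S.btempProdOverEtaleInverseIso hS hU h36 hcoh).symm _ ≪≫
    Functor.associator _ _ _ ≪≫
    Functor.isoWhiskerLeft (S.btempProdOver hS) (S.etaleEquiv hU h36 hcoh hS).counitIso ≪≫
    Functor.rightUnitor _

end BTempLevel

end CovObj

/-- ★★ **[SemiAnbd] Proposition 3.6 (v) IN FULL** ("the resulting morphism of temperoids
`B^temp(G′) → B^temp(G)` is étale", with Definition 3.4 (i) spelled out): for every `G` as in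
Proposition 3.6 that is coherent, every tempered `S` with covering `G_S → G`, there is an equivalence
`E : B^temp(G_S) ≌ B^temp(G)_S` under which the pull-back functor of `G_S → G` (2-cells `g_{b′}`) IS the
slice structure functor `T ↦ (S × T → S)` — unconditionally (`UniformSplitting` discharged by
`uniformSplitting_holds`). Upgrades the bare-equivalence typing `EtaleOfTemperedCovering` /
`etaleOfTemperedCovering_holds`. [cite: MochizukiSemiAnbd2006, Prop 3.6(v) p.39] -/
theorem etaleOfTemperedCovering_compat (𝒢 : ProfiniteSemiGraph.{u}) (h36 : 𝒢.Prop36Hypotheses)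
    (hcoh : 𝒢.IsCoherent) (S : CovObj 𝒢) (hS : S.IsTempered) :
    ∃ E : BTempCat S.coveringGraph ≌ Over (⟨S, hS⟩ : BTempCat 𝒢),
      Nonempty (S.coveringHom.btempPullbackWith S.coveringConjugators ⋙ E.functor ≅ S.btempProdOver hS) :=
  ⟨S.etaleEquiv uniformSplitting_holds h36 hcoh hS,
    ⟨S.btempPullbackEtaleFunctorIso hS uniformSplitting_holds h36 hcoh⟩⟩

end ProfiniteSemiGraph

end Literature.AnabelianGeometry.SemiGraphs

end
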